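import Mathlib
import Summits.NavierStokesRegularity.FluidComputer.AbcClassIComplexBasesTransfer
import Summits.NavierStokesRegularity.FluidComputer.AbcClassIIComplexBasesReality

/-!
# GROUP-B END-TO-END ON THE MODEL, CLASS I — ARBITRARY COMPLEX (UNITARY) ORBIT BASES (prep 4):
# REALITY of an isolated coordinate eigenvalue from conjugation in the real basis
(profile-cert-3 g9, cell `ns-blowup`, 2026-08-27; the class-I twin of the cert-3 g8 class-II file of the same name — same statements and proofs over the class-I layer `AbcClassI*`)

HONEST FRAMING (human rulings D-0035/D-0074): nothing here is a claim about Navier–Stokes blow-up.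
WHAT THIS IS NOT: not NS evidence. MODEL lane (NS linearised about the forced ABC flow `abcFlow 1 1 1`,
class I); no certificate, number or census word moves. Sequel of `AbcClassIIComplexBasesTransfer`.
**`im_eq_zero_of_isolated_coord_eigenvalue`**: the complex first-order matrix `amc` of a complex orthonormal
orbit-basis family `wf` is NOT a real matrix, so the REALITY step of the 3-B-nested theorem (cert-3 g4/g7:
`λ̃` real and `2ρ < r_iso` ⇒ `λ⋆` real, via a conjugation commuting with the operator) is re-proved through the
real basis: an `amc`-coordinate eigenvector `wc ≠ 0` for `λ⋆` with all polynomial moments finite is moved to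
instab4's REAL basis `bfam` (`ccoord_transfer`), conjugated there (`amat` is real, so `conj wa` solves the
equation for `conj λ⋆`), and moved back (`ccoord_transfer_back`): an `H²`-summable `amc`-eigenvector for
`conj λ⋆`, non-zero, with `|conj λ⋆ − λ⋆| ≤ 2|λ⋆ − λ̃| ≤ 2ρ < r_iso`; ISOLATION in `amc`-coordinates (every
`H²`-summable coordinate eigenvector with eigenvalue `z ≠ λ⋆`, `|z − λ⋆| < r_iso`, vanishes) forces
`conj λ⋆ = λ⋆`. Mathlib + the files named; no new definitions. bears_on LADDER-NS N5 / Z4-a(1). [folklore].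
-/

noncomputable section

open scoped BigOperators ComplexConjugate InnerProductSpace
open Finset

namespace Summit.NavierStokesRegularity.FluidComputer.AbcClassIEigenpair

open Literature.Analysis.FunctionSpaces Literature.Analysis.FunctionSpaces.Torus
open Literature.Analysis.FunctionSpaces.EuclideanSpace
open Literature.Analysis.FluidPDE Literature.Analysis.FluidPDE.SteadyLattice
open Summit.NavierStokesRegularity.FluidComputer.AbcClassI
open Summit.NavierStokesRegularity.FluidComputer.AbcClassII (Fam crossForm secOp rotR rotS sgnOrbit cube extend
  restrictTo Orbit toOrbit onormSq osupNorm cubeOrbits nbrOrbits mem_nbrOrbits mem_nbrOrbits_comm toOrbit_eq_iff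
  mem_cubeOrbits onormSq_nonneg neg_mem_of_orbitClosed inner_eq_sum_extend extend_apply_of_mem
  extend_apply_of_not_mem sq_osupNorm_le_onormSq kdot_cut sum_cube_filter_eq mem_sgnOrbit_self)

section ComplexBasesReality

variable (wf : Idx → Fam)
variable (hws : ∀ i : Idx, ∀ k ∉ i.1.1, wf i k = 0)
variable (hwt : ∀ (i : Idx) (k : Fin 3 → ℤ), ∑ j : Fin 3, ((k j : ℤ) : ℂ) * wf i k j = 0)
variable (hwI : ∀ i : Idx, IsClassI (wf i))
variable (hwon : ∀ (O : Orbit) (a b : Fin (odim O)),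
  ∑ k ∈ O.1, (inner ℂ (wf ⟨O, a⟩ k) (wf ⟨O, b⟩ k) : ℂ) = if a = b then 1 else 0)
variable (amc : Idx → Idx → ℂ)
variable (hamc : ∀ i j : Idx, amc i j =
  ∑ k ∈ i.1.1, (inner ℂ (wf i k) (Torus.lerayCoeff k (crossForm 1 1 1 (wf j) k)) : ℂ))

include hws hwt hwI hwon hamc in
/-- **REALITY of an isolated `amc`-coordinate eigenvalue close to a real trial value.** -/
theorem im_eq_zero_of_isolated_coord_eigenvalue {R : ℝ} (hR : 1 ≤ R) (lam lt : ℂ) {ρ riso : ℝ}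
    (wc : AbcClassI.Idx → ℂ) (hwc0 : wc ≠ 0)
    (hcoord : ∀ i : AbcClassI.Idx, ((-(onormSq i.1 / R) : ℝ) : ℂ) * wc i +
      ∑ j ∈ AbcClassI.nbrIdx i, amc i j * wc j = lam * wc i)
    (hwsum : Summable fun i : AbcClassI.Idx => (1 + onormSq i.1) ^ 2 * ‖wc i‖ ^ 2)
    (hclose : ‖lam - lt‖ ≤ ρ) (hlt : lt.im = 0) (h2ρ : 2 * ρ < riso)
    (hisol : ∀ z : ℂ, z ≠ lam → ‖z - lam‖ < riso →
      ∀ w : AbcClassI.Idx → ℂ, (Summable fun i : AbcClassI.Idx => (1 + onormSq i.1 / R) ^ 2 * ‖w i‖ ^ 2) →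
        (∀ i : AbcClassI.Idx, ((-(onormSq i.1 / R) : ℝ) : ℂ) * w i +
          ∑ j ∈ AbcClassI.nbrIdx i, amc i j * w j = z * w i) → w = 0) :
    lam.im = 0 := by
  classical
  have hR0 : 0 < R := by linarith
  -- transfer to instab4's real basis `bfam`
  obtain ⟨wa, -, hcoordA, hsumsA, hneA⟩ := ccoord_transfer wf hws hwt hwI hwon amc hamc lam wc hcoord
  -- the conjugate coordinates solve the `amat`-equation for `conj λ⋆` (`amat` is real)
  have hcoordB : ∀ i : Idx, ((-(onormSq i.1 / R) : ℝ) : ℂ) * conj (wa i) +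
      ∑ j ∈ nbrIdx i, ((amat i j : ℝ) : ℂ) * conj (wa j) = conj lam * conj (wa i) := by
    intro i
    have h := congrArg conj (hcoordA i)
    rw [map_add, map_mul, map_sum, map_mul, Complex.conj_ofReal] at h
    rw [← h]
    congr 1
    exact Finset.sum_congr rfl fun j _ => by rw [map_mul, Complex.conj_ofReal]
  -- and back
  obtain ⟨wb, -, hcoordC, hsumsC, hneC⟩ :=
    ccoord_transfer_back wf hws hwt hwI hwon amc hamc (conj lam) (fun i => conj (wa i)) hcoordB
  -- cube sums of `wb` are those of `wc`
  have hsumsBC : ∀ (n : ℕ) (g : Orbit → ℝ), ∑ i ∈ cubeIdx n, g i.1 * ‖wb i‖ ^ 2 =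
      ∑ i ∈ cubeIdx n, g i.1 * ‖wc i‖ ^ 2 := by
    intro n g
    rw [hsumsC n g, ← hsumsA n g]
    exact Finset.sum_congr rfl fun i _ => by rw [Complex.norm_conj]
  have hwsumB : Summable fun i : Idx => (1 + onormSq i.1 / R) ^ 2 * ‖wb i‖ ^ 2 := by
    have h2 : Summable fun i : Idx => (1 + onormSq i.1) ^ 2 * ‖wb i‖ ^ 2 :=
      summable_of_cube_sums (fun i => (1 + onormSq i.1) ^ 2)
        (fun i => pow_nonneg (by linarith [onormSq_nonneg i.1]) _) wc wb
        (fun n => hsumsBC n (fun O => (1 + onormSq O) ^ 2)) hwsum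
    refine Summable.of_nonneg_of_le (fun i => mul_nonneg (sq_nonneg _) (sq_nonneg _)) (fun i => ?_) h2
    have h3 : 1 + onormSq i.1 / R ≤ 1 + onormSq i.1 := by
      have h4 : onormSq i.1 / R ≤ onormSq i.1 := div_le_self (onormSq_nonneg i.1) hR
      linarith
    have h5 : 0 ≤ 1 + onormSq i.1 / R := by linarith [div_nonneg (onormSq_nonneg i.1) hR0.le]
    exact mul_le_mul_of_nonneg_right (pow_le_pow_left₀ h5 h3 2) (sq_nonneg _)
  have hwb0 : wb ≠ 0 := by
    refine hneC fun hall => hneA hwc0 (funext fun i => ?_)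
    simpa using congrFun hall i
  -- `conj λ⋆` is within `2ρ` of `λ⋆` (`λ̃` is real); isolation
  by_contra him
  have hne : conj lam ≠ lam := fun h => him (Complex.conj_eq_iff_im.mp h)
  have hdist : ‖conj lam - lam‖ ≤ 2 * ρ := by
    have hlt' : conj lt = lt := Complex.conj_eq_iff_im.mpr hlt
    have e1 : conj lam - lam = conj (lam - lt) - (lam - lt) := by rw [map_sub, hlt']; ring
    rw [e1]
    calc ‖conj (lam - lt) - (lam - lt)‖ ≤ ‖conj (lam - lt)‖ + ‖lam - lt‖ := norm_sub_le _ _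
      _ = 2 * ‖lam - lt‖ := by rw [Complex.norm_conj]; ring
      _ ≤ 2 * ρ := by linarith [hclose]
  exact hwb0 (hisol (conj lam) hne (lt_of_le_of_lt hdist h2ρ) wb hwsumB hcoordC)

end ComplexBasesReality

end Summit.NavierStokesRegularity.FluidComputer.AbcClassIEigenpair

end
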